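import Summits.QuantumFields.YangMills.Theorems.VirialFluxGapRingTreeGauge
import Summits.QuantumFields.YangMills.Theorems.LuscherReductionRunningReductionAxialConj
import HarnessLib

/-!
# The residual constant-`SU(2)` action on the tree-gauged ring space: action, measurability, invariance of `μ_fix` and of `F_fix`
# (layer (B2), structural inputs `hact ∕ hmul ∕ hone ∕ hpres ∕ hfinv` of ✓`laplaceMethod_quantitative_orbit_tube` on `X_fix`)

Helper module (free-hands work of width seat ym-line-sfw-p2-w2 g49, cell ym-idea-1).  On
`X_fix(L) = SU2^{off-tree} × (GaugeConfig 3 L SU2)^{2L−1} × SU2^{sites}` the residual symmetry after the tree gauge of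
✓`VirialFluxGapRingTreeGauge` is `k · (w, (f, g)) = ((k w_i k⁻¹)_i, ((k·f_j)_j, (k g_y k⁻¹)_y))`, `k ∈ SU(2)` (a CONSTANT gauge transformation):
* `fixGaugeAct_mul`, `fixGaugeAct_one` — it is an action;
* `continuous_fixGaugeAct`, `measurable_fixGaugeAct` — joint continuity ∕ measurability of `(k, x) ↦ k · x`;
* `measurePreserving_fixGaugeAct` — `μ_fix = Haar^{off} ⊗ (⊗ configMeasure) ⊗ gaugeMeasure` is invariant;
* ★ `ringDeficit_fix_fixGaugeAct` — `F_fix(k · x) = F_fix(x)` (✓`glue_conj'`, ✓`ringDeficit_ringGaugeAct`).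
Everything is PROVED; no definitions, no named facts.  HONEST FRAMING: bookkeeping; ⟨24204⟩, ⟨24319⟩ and every rung stay OPEN; the
Yang–Mills mass gap (Clay) is NOT touched; no summit is proved by a line.
-/

noncomputable section

open MeasureTheory Filter Set Function
open scoped BigOperators Topology ENNReal
open Literature.MathematicalPhysics.QuantumFieldTheory hiding SU2
open Literature.MathematicalPhysics.QuantumLattice (measurePreserving_mul_mul_inv_haarProbability)
open Summit.QuantumFields.YangMills.Theorems.FemtoTransferGap
open Summit.QuantumFields.YangMills.Theorems.FemtoTransferGap.TT

namespace Summit.QuantumFields.YangMills.Theorems.VirialFluxGap.RingDeficit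

variable {L : ℕ} [NeZero L]

/-! ## §1 The action -/

omit [NeZero L] in
/-- The residual action is multiplicative. [folklore] -/
theorem fixGaugeAct_mul (k k' : SU2) (x : (OffIdx L → SU2) × ((Fin (2 * L - 1) → GaugeConfig 3 L SU2) × (Site 3 L → SU2))) :
    (((fun i => (k * k') * x.1 i * (k * k')⁻¹),
      ((fun j => gaugeTransform (fun _ : Site 3 L => k * k') (x.2.1 j)), (fun y => (k * k') * x.2.2 y * (k * k')⁻¹))) :
        (OffIdx L → SU2) × ((Fin (2 * L - 1) → GaugeConfig 3 L SU2) × (Site 3 L → SU2))) =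
      ((fun i => k * (k' * x.1 i * k'⁻¹) * k⁻¹),
        ((fun j => gaugeTransform (fun _ : Site 3 L => k) (gaugeTransform (fun _ : Site 3 L => k') (x.2.1 j))),
          (fun y => k * (k' * x.2.2 y * k'⁻¹) * k⁻¹))) := by
  refine Prod.ext ?_ (Prod.ext ?_ ?_)
  · funext i; simp only [mul_inv_rev, mul_assoc]
  · funext j e; simp only [gaugeTransform, mul_inv_rev, mul_assoc]
  · funext y; simp only [mul_inv_rev, mul_assoc]

omit [NeZero L] in
/-- The trivial element acts trivially. [folklore] -/
theorem fixGaugeAct_one (x : (OffIdx L → SU2) × ((Fin (2 * L - 1) → GaugeConfig 3 L SU2) × (Site 3 L → SU2))) :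
    (((fun i => (1 : SU2) * x.1 i * (1 : SU2)⁻¹),
      ((fun j => gaugeTransform (fun _ : Site 3 L => (1 : SU2)) (x.2.1 j)), (fun y => (1 : SU2) * x.2.2 y * (1 : SU2)⁻¹))) :
        (OffIdx L → SU2) × ((Fin (2 * L - 1) → GaugeConfig 3 L SU2) × (Site 3 L → SU2))) = x := by
  refine Prod.ext ?_ (Prod.ext ?_ ?_)
  · funext i; simp
  · funext j e; simp [gaugeTransform]
  · funext y; simp

/-! ## §2 Continuity, measurability, invariance of the reduced measure -/

omit [NeZero L] in
/-- Joint continuity of `(k, x) ↦ k · x`. [folklore] -/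
theorem continuous_fixGaugeAct :
    Continuous fun q : SU2 × ((OffIdx L → SU2) × ((Fin (2 * L - 1) → GaugeConfig 3 L SU2) × (Site 3 L → SU2))) =>
      (((fun i => q.1 * q.2.1 i * q.1⁻¹),
        ((fun j => gaugeTransform (fun _ : Site 3 L => q.1) (q.2.2.1 j)), (fun y => q.1 * q.2.2.2 y * q.1⁻¹))) :
          (OffIdx L → SU2) × ((Fin (2 * L - 1) → GaugeConfig 3 L SU2) × (Site 3 L → SU2))) := by
  have hk : Continuous fun q : SU2 × ((OffIdx L → SU2) × ((Fin (2 * L - 1) → GaugeConfig 3 L SU2) × (Site 3 L → SU2))) =>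
      q.1 := continuous_fst
  refine Continuous.prodMk ?_ (Continuous.prodMk ?_ ?_)
  · refine continuous_pi fun i => ?_
    have h : Continuous fun q : SU2 × ((OffIdx L → SU2) × ((Fin (2 * L - 1) → GaugeConfig 3 L SU2) × (Site 3 L → SU2))) =>
        q.2.1 i := (continuous_apply i).comp (continuous_fst.comp continuous_snd)
    exact (hk.mul h).mul hk.inv
  · refine continuous_pi fun j => continuous_pi fun e => ?_
    have h : Continuous fun q : SU2 × ((OffIdx L → SU2) × ((Fin (2 * L - 1) → GaugeConfig 3 L SU2) × (Site 3 L → SU2))) =>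
        q.2.2.1 j e := (continuous_apply e).comp ((continuous_apply j).comp (continuous_fst.comp (continuous_snd.comp continuous_snd)))
    simp only [gaugeTransform]
    exact (hk.mul h).mul hk.inv
  · refine continuous_pi fun y => ?_
    have h : Continuous fun q : SU2 × ((OffIdx L → SU2) × ((Fin (2 * L - 1) → GaugeConfig 3 L SU2) × (Site 3 L → SU2))) =>
        q.2.2.2 y := (continuous_apply y).comp (continuous_snd.comp (continuous_snd.comp continuous_snd))
    exact (hk.mul h).mul hk.inv

omit [NeZero L] in
/-- Joint measurability of `(k, x) ↦ k · x` (input `hact`). [folklore] -/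
theorem measurable_fixGaugeAct :
    Measurable fun q : SU2 × ((OffIdx L → SU2) × ((Fin (2 * L - 1) → GaugeConfig 3 L SU2) × (Site 3 L → SU2))) =>
      (((fun i => q.1 * q.2.1 i * q.1⁻¹),
        ((fun j => gaugeTransform (fun _ : Site 3 L => q.1) (q.2.2.1 j)), (fun y => q.1 * q.2.2.2 y * q.1⁻¹))) :
          (OffIdx L → SU2) × ((Fin (2 * L - 1) → GaugeConfig 3 L SU2) × (Site 3 L → SU2))) := by
  have hk : Measurable fun q : SU2 × ((OffIdx L → SU2) × ((Fin (2 * L - 1) → GaugeConfig 3 L SU2) × (Site 3 L → SU2))) =>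
      q.1 := measurable_fst
  refine Measurable.prodMk ?_ (Measurable.prodMk ?_ ?_)
  · refine measurable_pi_lambda _ fun i => ?_
    have h : Measurable fun q : SU2 × ((OffIdx L → SU2) × ((Fin (2 * L - 1) → GaugeConfig 3 L SU2) × (Site 3 L → SU2))) =>
        q.2.1 i := (measurable_pi_apply i).comp (measurable_fst.comp measurable_snd)
    exact (hk.mul h).mul hk.inv
  · refine measurable_pi_lambda _ fun j => measurable_pi_lambda _ fun e => ?_
    have h : Measurable fun q : SU2 × ((OffIdx L → SU2) × ((Fin (2 * L - 1) → GaugeConfig 3 L SU2) × (Site 3 L → SU2))) =>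
        q.2.2.1 j e := (measurable_pi_apply e).comp ((measurable_pi_apply j).comp (measurable_fst.comp (measurable_snd.comp measurable_snd)))
    simp only [gaugeTransform]
    exact (hk.mul h).mul hk.inv
  · refine measurable_pi_lambda _ fun y => ?_
    have h : Measurable fun q : SU2 × ((OffIdx L → SU2) × ((Fin (2 * L - 1) → GaugeConfig 3 L SU2) × (Site 3 L → SU2))) =>
        q.2.2.2 y := (measurable_pi_apply y).comp (measurable_snd.comp (measurable_snd.comp measurable_snd))
    exact (hk.mul h).mul hk.inv

/-- ★ **The reduced measure is invariant** under the residual action (input `hpres`). [folklore] -/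
theorem measurePreserving_fixGaugeAct (k : SU2) :
    MeasurePreserving (fun x : (OffIdx L → SU2) × ((Fin (2 * L - 1) → GaugeConfig 3 L SU2) × (Site 3 L → SU2)) =>
      (((fun i => k * x.1 i * k⁻¹),
        ((fun j => gaugeTransform (fun _ : Site 3 L => k) (x.2.1 j)), (fun y => k * x.2.2 y * k⁻¹))) :
          (OffIdx L → SU2) × ((Fin (2 * L - 1) → GaugeConfig 3 L SU2) × (Site 3 L → SU2))))
      ((Measure.pi fun _ : OffIdx L => haarProbability SU2).prod
        ((Measure.pi fun _ : Fin (2 * L - 1) => configMeasure SU2 L).prod (gaugeMeasure L)))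
      ((Measure.pi fun _ : OffIdx L => haarProbability SU2).prod
        ((Measure.pi fun _ : Fin (2 * L - 1) => configMeasure SU2 L).prod (gaugeMeasure L))) := by
  haveI : IsProbabilityMeasure (gaugeMeasure L) := by unfold gaugeMeasure; infer_instance
  have ha : MeasurePreserving (fun w : OffIdx L → SU2 => fun i => k * w i * k⁻¹)
      (Measure.pi fun _ : OffIdx L => haarProbability SU2) (Measure.pi fun _ : OffIdx L => haarProbability SU2) :=
    measurePreserving_pi (f := fun (_ : OffIdx L) (u : SU2) => k * u * k⁻¹) _ _
      fun _ => measurePreserving_mul_mul_inv_haarProbability k k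
  have hb : MeasurePreserving (fun Us : Fin (2 * L - 1) → GaugeConfig 3 L SU2 => fun j => gaugeTransform (fun _ : Site 3 L => k) (Us j))
      (Measure.pi fun _ : Fin (2 * L - 1) => configMeasure SU2 L)
      (Measure.pi fun _ : Fin (2 * L - 1) => configMeasure SU2 L) :=
    measurePreserving_pi (f := fun (_ : Fin (2 * L - 1)) (U : GaugeConfig 3 L SU2) => gaugeTransform (fun _ : Site 3 L => k) U) _ _
      fun _ => Literature.Barriers.QuantumFields.Elitzur.measurePreserving_gaugeTransform (fun _ : Site 3 L => k)
  have hc : MeasurePreserving (fun g : Site 3 L → SU2 => fun y => k * g y * k⁻¹) (gaugeMeasure L) (gaugeMeasure L) :=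
    measurePreserving_pi (f := fun (_ : Site 3 L) (u : SU2) => k * u * k⁻¹) _ _
      fun _ => measurePreserving_mul_mul_inv_haarProbability k k
  exact ha.prod (hb.prod hc)

/-! ## §3 Invariance of the reduced phase -/

/-- ★ **`F_fix(k · x) = F_fix(x)`** (input `hfinv`): a constant gauge transformation maps `glue w` to `glue(k w k⁻¹)` (✓`glue_conj'`) and the
twisted deficit is gauge invariant (✓`ringDeficit_ringGaugeAct`). [cite: Luscher1983, §2] -/
theorem ringDeficit_fix_fixGaugeAct (z : Fin 3 → Bool) (k : SU2)
    (x : (OffIdx L → SU2) × ((Fin (2 * L - 1) → GaugeConfig 3 L SU2) × (Site 3 L → SU2))) :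
    ringDeficit L z ((Fin.cons (glue fun i => k * x.1 i * k⁻¹) (fun j => gaugeTransform (fun _ : Site 3 L => k) (x.2.1 j)) :
        Fin (2 * L - 1 + 1) → GaugeConfig 3 L SU2), fun y => k * x.2.2 y * k⁻¹) =
      ringDeficit L z ((Fin.cons (glue x.1) x.2.1 : Fin (2 * L - 1 + 1) → GaugeConfig 3 L SU2), x.2.2) := by
  rw [← ringDeficit_ringGaugeAct z (fun _ : Site 3 L => k)
    ((Fin.cons (glue x.1) x.2.1 : Fin (2 * L - 1 + 1) → GaugeConfig 3 L SU2), x.2.2)]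
  congr 1
  refine Prod.ext ?_ ?_
  · funext i
    refine Fin.cases ?_ (fun j => ?_) i
    · simp only [Fin.cons_zero, glue_conj']
    · simp only [Fin.cons_succ]
  · funext y
    simp only [Pi.mul_apply, Pi.inv_apply]

end Summit.QuantumFields.YangMills.Theorems.VirialFluxGap.RingDeficit
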